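import Summits.QuantumFields.YangMills.Theorems.DiagonalMirrorRPRWilsonDiagonalModelShiftedSpectralPairing
import Summits.QuantumFields.YangMills.Theorems.DiagonalMirrorRPRWilsonDiagonalModelShiftedObservable
import Summits.QuantumFields.YangMills.Theorems.DiagonalMirrorRPRWilsonDiagonalModelPinned
import Literature.Analysis.OperatorTheory.IntegralOperatorHilbertSchmidt
import Literature.Analysis.OperatorTheory.HilbertSchmidtPairing

/-!
# Crux `WeakCouplingHypercubicLimitRP` (stmt-QuantumFields-27398) / aside `DiagonalMirrorRPR` (stmt-QuantumFields-10604), door B, R1-side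
# supply chain of D1′ (`stub_oddTorusSwapPairingLiminf`), item (ii) step 5: the TWO-SHIFT FORMULA on the eigen-package —
# `Tr K_u^{S_k} · swapShiftPairing r sch Y n k = Σ_{(a,b)} w_k(a,b) · κ_b^{2n} · κ_a^{S_k − 2n − 2d}`

Helper file (`--supports stmt-QuantumFields-27398 --as helper`) of the hand `hand-10604-wilsonDiagModel-2` g3 (docket director-ym g24, O4 WORD 47 (2) /
48 (1): item (ii), «ending in the two-insertion `HasSum` identity on `slicePkgAt` that hand-3's (iv-b) normalisation consumes»); it closes nothing by
itself.

WHAT.  On hand-1/hand-2's eigen-package `P : SlicePkg S G Nc ρ β` of one diagonal slice (`…PairingDefs`: THE `L²(μ̃)` operator of the reweighted lifted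
kernel `𝔟`, a Hilbert basis `bᵢ` of eigenvectors, eigenvalues `κᵢ`, `Σᵢ κᵢ^{m} = Tr K_u^{m}`):
* §1 DEFINITIONS (reviewed): the two-index transfer element `P.halfElem f j i = ∫ bⱼ(v) ∫ halfBlockT f (v,x) bᵢ(x) dμ̃ dμ̃ = ⟪bⱼ, 𝒯_f bᵢ⟫` (written out, no
  operator chosen; `halfElem_eq_inner`) and the **two-shift weight** `P.twoShiftWeight f a b = (P.halfElem f b a)²` — the weight with which the far mode
  `a` and the gap mode `b` enter the shifted reflected pairing of the depth-`(e+1)` observable `f`; `twoShiftWeight_nonneg`, `summable_twoShiftWeight`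
  (`Σ_{(a,b)} w(a,b) = ‖𝒯_f‖²_{HS} < ∞`, tree `hasSum_norm_toLp_integral_kernel_mul_sq` + `summable_inner_mul_inner_prod`);
* §2 ★★★ **`SlicePkg.hasSum_twoShift`** — for a `diagBox T`-local bounded measurable `Y`, a reading depth `e + 1 ≥ 2T`, a shift `n ≥ 1` with room
  `2n + 2(e+1) + 2 ≤ S_k`:
  `HasSum (fun p ↦ w(p.1, p.2) · κ_{p.2}^{2n} · κ_{p.1}^{S_k − 2n − 2(e+1)}) (swapShiftPairing r sch Y n k · Tr K_u^{S_k})`, `w = P.twoShiftWeight (obsRead S_k Y e)`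
  — `…ShiftedObservable` (the reading) + `…ShiftedSpectralPairing` (the two-insertion trace formula); and the instance ON THE MODEL OF RECORD's package,
  `hasSum_twoShift_slicePkgAt` (`P := slicePkgAt r sch hβ k`, ✓ `…WilsonDiagonalModelPinned`).
  In hand-3's currency (`…TwoShiftExtractionTsum`, family `ω p.1 p.2 · x_{p.2}^{2m} · (σ_{p.1} x_{p.1})^{N−2m−2d}`): `N = S_k`, `d = e + 1`, `m = n`, `ω ∝ w`
  after the normalisation `x = |κ|/top`, `σ = sgn κ` — (iv-b) is hand-3's.  With `Σᵢ κᵢ^{S_k} = Tr K_u^{S_k} > 0` (`P.trace`) this is the promised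
  `Z_N · P_n = Σ w κ_b^{2n} κ_a^{N − 2n − 2d}` for BOTH shifts `n` and `2n` of the pinned probe (apply the theorem at `n` and at `2n`).

HONEST FRAMING: an identity of the transfer-matrix formalism (two-point function of a shifted box observable through the eigen-data of the diagonal
two-step transfer operator), kernel-checked on hand-1's construction; it says NOTHING about the size of the weights or of the eigenvalues — the letters K1
`CoarseGap ∧ JunkVisible`, K2 `SlowestVisible`, the coupling letter `SlowCoupled`, R2♭ remain OPEN physics; D1′, ⟨27398⟩ (0∕2), S6i and the aside ⟨10604⟩ are
OPEN; nothing here bears on the summit; the Yang–Mills mass gap is NOT proved here or anywhere in the tree.  Two `def`s (§1), no instance, no notation,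
`autoImplicit false`.

References: K. Osterwalder, E. Seiler, Ann. Phys. 110 (1978) §2–3; I. Montvay, G. Münster (1994) §1.5.2 (1.195)–(1.196); B. Simon, *Trace Ideals* (2005)
Ch. 3; M. Reed, B. Simon I (1980) Thm. VI.22–VI.23.
-/

set_option autoImplicit false

noncomputable section

open scoped BigOperators ENNReal RealInnerProductSpace
open MeasureTheory Function Filter Topology
open Literature.MathematicalPhysics.QuantumLattice Literature.MathematicalPhysics.QuantumFieldTheory
open Summit.QuantumFields.YangMills.Cruxes.DiagonalMirrorRPR.ParityBridgeColdTraces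
open Summit.QuantumFields.YangMills.Cruxes.DiagonalMirrorRPR.SpectralTransfer (swapShiftPairing diagBox)

namespace Summit.QuantumFields.YangMills.Cruxes.DiagonalMirrorRPR.SignTwistedDiagonalTrace.WilsonDiagonal

/-! ## §1 Two-index transfer elements and two-shift weights of an eigen-package -/

section Weights

variable {S : ℕ} [NeZero S] {G : Type} [Group G] {Nc : ℕ} {ρ : G →* Matrix (Fin Nc) (Fin Nc) ℂ}
variable [TopologicalSpace G] [IsTopologicalGroup G] [CompactSpace G] [MeasurableSpace G] [BorelSpace G] {β : ℝ}

/-- **The two-index transfer element** `⟪bⱼ, 𝒯_f bᵢ⟫` of the eigen-package for an observable `f` of depth `e + 1`, written out: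
`∫ bⱼ(v) ∫ halfBlockT f (v, x) bᵢ(x) dμ̃(x) dμ̃(v)` — the amplitude for the mode `bᵢ` arriving at the block boundary to be transported across the `e + 1`
layers carrying `f` and met by the mode `bⱼ` at the reflection layer. -/
def SlicePkg.halfElem (P : SlicePkg S G Nc ρ β) {e : ℕ} (f : (Fin (e + 1) → HalfCfg S S G) → (Fin (e + 1) → HalfCfg S S G) → ℝ)
    (j i : P.s) : ℝ :=
  ∫ v, P.b j v * ∫ x, halfBlockT S G Nc ρ β P.M f v x * P.b i x ∂(tMeasure S G Nc β P.M) ∂(tMeasure S G Nc β P.M)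

/-- **The two-shift weight** `w(a, b) = ⟪b_b, 𝒯_f b_a⟫²` of the far mode `a` and the gap mode `b` for the observable `f`: the (un-normalised) two-index
weight `ω(a, b)` of the shifted sandwich `…TwoShiftExtraction.sandwich`. -/
def SlicePkg.twoShiftWeight (P : SlicePkg S G Nc ρ β) {e : ℕ} (f : (Fin (e + 1) → HalfCfg S S G) → (Fin (e + 1) → HalfCfg S S G) → ℝ)
    (a b : P.s) : ℝ :=
  P.halfElem f b a ^ 2

/-- The two-shift weights are non-negative. -/
theorem SlicePkg.twoShiftWeight_nonneg (P : SlicePkg S G Nc ρ β) {e : ℕ}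
    (f : (Fin (e + 1) → HalfCfg S S G) → (Fin (e + 1) → HalfCfg S S G) → ℝ) (a b : P.s) : 0 ≤ P.twoShiftWeight f a b :=
  sq_nonneg _

/-- The transfer element IS `⟪bⱼ, 𝒯_f bᵢ⟫` for any bounded operator `𝒯_f` given a.e. by the kernel `halfBlockT f`. -/
theorem SlicePkg.halfElem_eq_inner (P : SlicePkg S G Nc ρ β) {e : ℕ}
    (f : (Fin (e + 1) → HalfCfg S S G) → (Fin (e + 1) → HalfCfg S S G) → ℝ)
    {T : Lp ℝ 2 (tMeasure S G Nc β P.M) →L[ℝ] Lp ℝ 2 (tMeasure S G Nc β P.M)}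
    (hT : ∀ φ : Lp ℝ 2 (tMeasure S G Nc β P.M), (T φ : ℕ × HalfCfg S S G → ℝ) =ᵐ[tMeasure S G Nc β P.M]
      fun v => ∫ x, halfBlockT S G Nc ρ β P.M f v x * φ x ∂(tMeasure S G Nc β P.M)) (j i : P.s) :
    P.halfElem f j i = ⟪P.b j, T (P.b i)⟫ := by
  rw [Literature.Analysis.OperatorTheory.inner_kernelOp_eq_integral hT]
  rfl

variable [SecondCountableTopology G]

/-- **The two-shift weights are summable**: `Σ_{(a,b)} ⟪b_b, 𝒯_f b_a⟫² = ‖𝒯_f‖²_{HS} < ∞` (`𝒯_f` has a bounded kernel on the finite measure space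
`(ℕ × HalfCfg, μ̃)`, hence is Hilbert–Schmidt; Parseval along the basis). -/
theorem SlicePkg.summable_twoShiftWeight (hρ : Continuous ρ) (hβ : 0 ≤ β) (P : SlicePkg S G Nc ρ β) {e : ℕ}
    {f : (Fin (e + 1) → HalfCfg S S G) → (Fin (e + 1) → HalfCfg S S G) → ℝ} (hf : Measurable (uncurry f))
    {B : ℝ} (hB : ∀ Y X, |f Y X| ≤ B) :
    Summable fun p : P.s × P.s => P.twoShiftWeight f p.1 p.2 := by
  haveI := isFiniteMeasure_tMeasure (S := S) (G := G) (Nc := Nc) hβ P.M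
  haveI := P.countable
  obtain ⟨C, hC0, hC⟩ := exists_abs_openLink_le ρ hρ β P.hM
  obtain ⟨CT, -, hCT⟩ := exists_abs_halfBlockT_le (S := S) (Nc := Nc) ρ hβ P.M hC0.le hC hB (e := e)
  have hX : StronglyMeasurable (uncurry (halfBlockT S G Nc ρ β P.M f)) := (measurable_halfBlockT (S := S) ρ hρ hβ P.M hf).stronglyMeasurable
  have hCX : ∀ v x : ℕ × HalfCfg S S G, ‖halfBlockT S G Nc ρ β P.M f v x‖ ≤ CT := fun v x => by
    rw [Real.norm_eq_abs]; exact hCT v x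
  obtain ⟨T, hT⟩ := exists_halfBlockOp (S := S) (Nc := Nc) ρ hρ hβ P.hM hf hB (e := e)
  -- `𝒯_f` is Hilbert–Schmidt along the eigenbasis
  have hT2 : Summable fun i : P.s => ‖T (P.b i)‖ ^ 2 := by
    have h := Literature.Analysis.OperatorTheory.hasSum_norm_toLp_integral_kernel_mul_sq (𝕜 := ℝ) hX hCX P.b
    refine h.summable.congr fun i => ?_
    have hi : T (P.b i) = (Literature.Analysis.OperatorTheory.memLp_two_integral_kernel_mul hX hCX (P.b i)).toLp _ :=
      Lp.ext ((hT (P.b i)).trans (MemLp.coeFn_toLp _).symm)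
    rw [hi]
  have hs := Literature.Analysis.OperatorTheory.summable_inner_mul_inner_prod P.b P.b T T hT2 hT2
  refine hs.congr fun p => ?_
  unfold SlicePkg.twoShiftWeight
  rw [P.halfElem_eq_inner f hT, real_inner_comm (P.b p.2) (T (P.b p.1)), sq]

end Weights

/-! ## §2 ★★★ The two-shift formula on the eigen-package of a diagonal slice -/

section TwoShift

variable {G : Type} [Group G] [TopologicalSpace G] [IsTopologicalGroup G] [CompactSpace G] [MeasurableSpace G] [BorelSpace G]
  (r : LatticeRep G) (sch : SpeciesScheme (YMSpecies G))

/-- ★★★ **The two-shift formula.**  Let `P` be an eigen-package of the diagonal slice at step `k` (`β_k ≥ 0`), `Y` a bounded measurable `diagBox T`-local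
functional, `e + 1 ≥ 2T` a reading depth and `n ≥ 1` a shift with room `2n + 2(e+1) + 2 ≤ S_k`.  Then
`Σ_{(a,b)} w(a,b) · κ_b^{2n} · κ_a^{S_k − 2n − 2(e+1)} = swapShiftPairing r sch Y n k · Tr K_u^{S_k}` as a `HasSum` over `P.s × P.s`
(`w = P.twoShiftWeight (obsRead S_k Y e)`, far mode `a = p.1` with the signed power, gap mode `b = p.2` with the even power `2n` — the layer gap between the
mirror image of the box and its diagonal translate by `n(e₀ − e₁)` is `2n`). -/
theorem SlicePkg.hasSum_twoShift {k : ℕ} (hβ : 0 ≤ sch.β k) (P : SlicePkg (sch.side k) G r.N r.ρ (sch.β k))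
    {Y : LGConfig 4 G → ℝ} (hYm : Measurable Y) {B : ℝ} (hYb : ∀ V, |Y V| ≤ B) {T : ℕ} (hYT : DependsOn Y (diagBox T))
    {e n : ℕ} (h2T : 2 * T ≤ e + 1) (hn : 1 ≤ n) (hroom : 2 * n + 2 * (e + 1) + 2 ≤ sch.side k) :
    HasSum (fun p : P.s × P.s =>
        P.twoShiftWeight (obsRead (sch.side k) Y e) p.1 p.2 * (P.κ p.2 ^ (2 * n) * P.κ p.1 ^ (sch.side k - 2 * n - 2 * (e + 1))))
      (swapShiftPairing r sch Y n k * diagCyclicTraceU r.ρ (sch.β k) (sch.side k) (S := sch.side k) (G := G)) := by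
  haveI : SecondCountableTopology G := (r.continuous.isClosedEmbedding r.injective).isEmbedding.secondCountableTopology
  haveI := P.countable
  haveI : NeZero (sch.side k) := ⟨by omega⟩
  -- exponents: gap `a + 2 = 2n`, far arc `b' + 2 = S_k − 2n − 2(e+1)`
  obtain ⟨a, ha⟩ : ∃ a : ℕ, 2 * n = a + 2 := ⟨2 * n - 2, by omega⟩
  obtain ⟨b', hb'⟩ : ∃ b' : ℕ, sch.side k - 2 * n - 2 * (e + 1) = b' + 2 := ⟨sch.side k - 2 * n - 2 * (e + 1) - 2, by omega⟩
  have hm : sch.side k = 2 * e + a + b' + 6 := by omega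
  -- the reading of `Y` and its transport operator
  have hf := measurable_obsRead (S := sch.side k) hYm e
  have hfB := abs_obsRead_le (S := sch.side k) hYb e
  obtain ⟨Tf, hTf⟩ := exists_halfBlockOp (S := sch.side k) (Nc := r.N) r.ρ r.continuous hβ P.hM hf hfB (e := e)
  have key := hasSum_pow_mul_pow_mul_sq_inner_halfBlockOp (S := sch.side k) (Nc := r.N) r.ρ r.continuous hβ r.mem_unitary P.hM P.hA P.hb
    hf hfB hTf a b' hm
  have hD := swapShiftPairing_mul_diagCyclicTraceU_eq_integral_pairs r sch Y hYT k e n h2T (by omega)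
  rw [ha] at hD
  rw [← hD] at key
  have hfun : (fun p : P.s × P.s =>
      P.twoShiftWeight (obsRead (sch.side k) Y e) p.1 p.2 * (P.κ p.2 ^ (2 * n) * P.κ p.1 ^ (sch.side k - 2 * n - 2 * (e + 1)))) =
      fun p : P.s × P.s => P.κ p.2 ^ (a + 2) * P.κ p.1 ^ (b' + 2) * ⟪P.b p.2, Tf (P.b p.1)⟫ ^ 2 := by
    funext p
    rw [hb', ha, SlicePkg.twoShiftWeight, P.halfElem_eq_inner _ hTf]
    ring
  rw [hfun]
  exact key

/-- ★★★ **The two-shift formula on the model of record's eigen-package** `slicePkgAt r sch hβ k` (✓ `…WilsonDiagonalModelPinned`): the instance of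
`SlicePkg.hasSum_twoShift` that the sandwich instance `twoShiftProbesAt` reads (at the pinned probe's shifts `n_k` and `2 n_k`). -/
theorem hasSum_twoShift_slicePkgAt (hβ : ∀ k, 0 ≤ sch.β k) (k : ℕ)
    {Y : LGConfig 4 G → ℝ} (hYm : Measurable Y) {B : ℝ} (hYb : ∀ V, |Y V| ≤ B) {T : ℕ} (hYT : DependsOn Y (diagBox T))
    {e n : ℕ} (h2T : 2 * T ≤ e + 1) (hn : 1 ≤ n) (hroom : 2 * n + 2 * (e + 1) + 2 ≤ sch.side k) :
    HasSum (fun p : (slicePkgAt r sch hβ k).s × (slicePkgAt r sch hβ k).s =>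
        (slicePkgAt r sch hβ k).twoShiftWeight (obsRead (sch.side k) Y e) p.1 p.2 *
          ((slicePkgAt r sch hβ k).κ p.2 ^ (2 * n) * (slicePkgAt r sch hβ k).κ p.1 ^ (sch.side k - 2 * n - 2 * (e + 1))))
      (swapShiftPairing r sch Y n k * diagCyclicTraceU r.ρ (sch.β k) (sch.side k) (S := sch.side k) (G := G)) :=
  SlicePkg.hasSum_twoShift r sch (hβ k) (slicePkgAt r sch hβ k) hYm hYb hYT h2T hn hroom

end TwoShift

end Summit.QuantumFields.YangMills.Cruxes.DiagonalMirrorRPR.SignTwistedDiagonalTrace.WilsonDiagonal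

end
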